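import Summits.ValiantsHypothesis.ValiantsHypothesis.Theorems.RigidityForcesSymmetryGrenetFirstOrderRankRigidWindows

/-!
# Route RigidityForcesSymmetry — `GrenetFirstOrderRankRigid` (item stmt-ValiantsHypothesis-21029),
line `grenet_gauge`: stub `stub_linearRigid`, step 5 — DESIGN WORDS and their valid splits

For the crux line `Cruxes/GrenetFirstOrderRankRigid/Lines/grenet_gauge.lean` (blueprint
`Lines/grenet_gauge-stub_linearRigid-PROOF.md`, §5, block I=; interface `…-BLOCKS.md`).  A DESIGN WORD
is `r = [X in increasing order] ++ mid ++ [Y in increasing order]` for `X, Y ⊆ Fin n` (`|X| = s`,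
`|Y| = n - s - m`) and a middle block `mid : Fin m → Fin n`; it is handed to the lemmas through its
defining equation `hr`.  Contents: generic (in)validity of a split from a repeated letter
(`suf_card_ne_of_repeat`, `pre_card_ne_of_repeat`); the letters and the prefix / suffix images of a
design word (`designWord_apply_*`, `designWord_mem_X/Y`, `designWord_pre`, `designWord_suf`); **the valid
splits of a design word are exactly the middle positions** (`designWord_valid_iff`) when the middle
letters other than the last avoid `X`, those other than the first avoid `Y`, distinct middle positions
carry distinct letters except possibly first = last, the first middle letter recurs later and the last
one occurred earlier; and `grenet_window_identity'` (the window identity with row / column indices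
required only at valid splits).  No new definitions.  VP ≠ VNP is not moved by this file.
-/

noncomputable section

open MvPolynomial Matrix Finset

namespace Summit.ValiantsHypothesis.Theorems.RigidityForcesSymmetry.GrenetGauge

open Literature.Computability.AlgebraicComplexity

/-! ### Generic (in)validity of splits -/

section Splits

variable {n : ℕ} (r : Fin n → Fin n)

/-- A split `c` is not suffix-valid if two positions after `c` carry the same letter. [folklore] -/
theorem suf_card_ne_of_repeat (c p₁ p₂ : Fin n) (hne : p₁ ≠ p₂) (h1 : (c : ℕ) < p₁) (h2 : (c : ℕ) < p₂)
    (heq : r p₁ = r p₂) :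
    ((univ.filter fun c' : Fin n => (c : ℕ) < c').image r).card ≠ n - 1 - c := by
  intro h
  have hcard : (univ.filter fun c' : Fin n => (c : ℕ) < c').card = n - 1 - c := by
    have : (univ.filter fun c' : Fin n => (c : ℕ) < c') = (univ.filter fun c' : Fin n => (c' : ℕ) < c + 1)ᶜ := by
      ext c'; simp only [Finset.mem_filter, Finset.mem_univ, true_and, Finset.mem_compl]; omega
    rw [this, Finset.card_compl, Fin.card_filter_val_lt, Fintype.card_fin]; have := c.isLt; omega
  have hinj : Set.InjOn r (univ.filter fun c' : Fin n => (c : ℕ) < c') :=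
    Finset.card_image_iff.mp (h.trans hcard.symm)
  exact hne (hinj (Finset.mem_coe.mpr (Finset.mem_filter.mpr ⟨Finset.mem_univ _, h1⟩))
    (Finset.mem_coe.mpr (Finset.mem_filter.mpr ⟨Finset.mem_univ _, h2⟩)) heq)

/-- A split `c` is not prefix-valid if two positions before `c` carry the same letter. [folklore] -/
theorem pre_card_ne_of_repeat (c p₁ p₂ : Fin n) (hne : p₁ ≠ p₂) (h1 : (p₁ : ℕ) < c) (h2 : (p₂ : ℕ) < c)
    (heq : r p₁ = r p₂) :
    ((univ.filter fun c' : Fin n => (c' : ℕ) < c).image r).card ≠ c := by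
  intro h
  have hcard : (univ.filter fun c' : Fin n => (c' : ℕ) < c).card = c := by
    rw [Fin.card_filter_val_lt]; exact min_eq_right c.isLt.le
  have hinj : Set.InjOn r (univ.filter fun c' : Fin n => (c' : ℕ) < c) :=
    Finset.card_image_iff.mp (h.trans hcard.symm)
  exact hne (hinj (Finset.mem_coe.mpr (Finset.mem_filter.mpr ⟨Finset.mem_univ _, h1⟩))
    (Finset.mem_coe.mpr (Finset.mem_filter.mpr ⟨Finset.mem_univ _, h2⟩)) heq)

end Splits

/-! ### Design words -/

section DesignWord

variable {n s m : ℕ} (X Y : Finset (Fin n)) (hX : X.card = s) (hY : Y.card = n - s - m)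
  (hsm : s + m ≤ n) (mid : Fin m → Fin n) (r : Fin n → Fin n)
  (hr : ∀ c : Fin n, r c =
    if h : (c : ℕ) < s then ((X.orderIsoOfFin hX ⟨c, h⟩ : X) : Fin n)
    else if h' : (c : ℕ) - s < m then mid ⟨(c : ℕ) - s, h'⟩
    else ((Y.orderIsoOfFin hY ⟨(c : ℕ) - s - m, by have := c.isLt; omega⟩ : Y) : Fin n))

include hsm hr

/-- The letters of the first block of a design word. [folklore] -/
theorem designWord_apply_lt (c : Fin n) (hc : (c : ℕ) < s) :
    r c = ((X.orderIsoOfFin hX ⟨c, hc⟩ : X) : Fin n) := by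
  rw [hr, dif_pos hc]

/-- The letters of the middle block of a design word. [folklore] -/
theorem designWord_apply_mid (c : Fin n) (h1 : s ≤ (c : ℕ)) (h2 : (c : ℕ) < s + m) :
    r c = mid ⟨(c : ℕ) - s, by omega⟩ := by
  rw [hr, dif_neg (by omega), dif_pos (by omega)]

/-- The letters of the last block of a design word. [folklore] -/
theorem designWord_apply_ge (c : Fin n) (h : s + m ≤ (c : ℕ)) :
    r c = ((Y.orderIsoOfFin hY ⟨(c : ℕ) - s - m, by have := c.isLt; omega⟩ : Y) : Fin n) := by
  rw [hr, dif_neg (by omega), dif_neg (by omega)]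

/-- Every letter of `X` occurs in the first block. [folklore] -/
theorem designWord_mem_X {x : Fin n} (hx : x ∈ X) : ∃ c : Fin n, (c : ℕ) < s ∧ r c = x := by
  obtain ⟨t, ht⟩ : ∃ t : Fin s, ((X.orderIsoOfFin hX t : X) : Fin n) = x :=
    ⟨(X.orderIsoOfFin hX).symm ⟨x, hx⟩, by rw [OrderIso.apply_symm_apply]⟩
  refine ⟨⟨t, by have := t.isLt; omega⟩, t.isLt, ?_⟩
  rw [designWord_apply_lt X Y hX hY hsm mid r hr _ t.isLt, ← ht]

/-- Every letter of `Y` occurs in the last block. [folklore] -/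
theorem designWord_mem_Y {y : Fin n} (hy : y ∈ Y) : ∃ c : Fin n, s + m ≤ (c : ℕ) ∧ r c = y := by
  obtain ⟨t, ht⟩ : ∃ t : Fin (n - s - m), ((Y.orderIsoOfFin hY t : Y) : Fin n) = y :=
    ⟨(Y.orderIsoOfFin hY).symm ⟨y, hy⟩, by rw [OrderIso.apply_symm_apply]⟩
  refine ⟨⟨s + m + t, by have := t.isLt; omega⟩, Nat.le_add_right _ _, ?_⟩
  rw [designWord_apply_ge X Y hX hY hsm mid r hr _ (Nat.le_add_right _ _), ← ht]
  congr 2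
  exact Fin.ext (by simp only; omega)

/-- **Prefix images of a design word**: `r({c < s + j}) = X ∪ mid({i < j})` for `j ≤ m`. [folklore] -/
theorem designWord_pre (j : ℕ) (hj : j ≤ m) :
    (univ.filter fun c : Fin n => (c : ℕ) < s + j).image r
      = X ∪ (univ.filter fun i : Fin m => (i : ℕ) < j).image mid := by
  ext x
  simp only [Finset.mem_image, Finset.mem_filter, Finset.mem_univ, true_and, Finset.mem_union]
  constructor
  · rintro ⟨c, hc, rfl⟩
    by_cases h : (c : ℕ) < s
    · left
      rw [designWord_apply_lt X Y hX hY hsm mid r hr c h]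
      exact Subtype.prop _
    · right
      exact ⟨⟨(c : ℕ) - s, by omega⟩, by show (c : ℕ) - s < j; omega,
        (designWord_apply_mid X Y hX hY hsm mid r hr c (by omega) (by omega)).symm⟩
  · rintro (hx | ⟨i, hi, rfl⟩)
    · obtain ⟨c, hc, hcx⟩ := designWord_mem_X X Y hX hY hsm mid r hr hx
      exact ⟨c, by omega, hcx⟩
    · refine ⟨⟨s + i, by have := i.isLt; omega⟩, by show s + (i : ℕ) < s + j; omega, ?_⟩
      rw [designWord_apply_mid X Y hX hY hsm mid r hr _ (Nat.le_add_right _ _) (Nat.add_lt_add_left i.isLt s)]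
      congr 1
      exact Fin.ext (by simp)

/-- **Suffix images of a design word**: `r({c > s + j}) = Y ∪ mid({i > j})` for `j < m`. [folklore] -/
theorem designWord_suf (j : ℕ) (hj : j < m) :
    (univ.filter fun c : Fin n => s + j < (c : ℕ)).image r
      = Y ∪ (univ.filter fun i : Fin m => j < (i : ℕ)).image mid := by
  ext x
  simp only [Finset.mem_image, Finset.mem_filter, Finset.mem_univ, true_and, Finset.mem_union]
  constructor
  · rintro ⟨c, hc, rfl⟩
    by_cases h : (c : ℕ) < s + m
    · right
      exact ⟨⟨(c : ℕ) - s, by omega⟩, by show j < (c : ℕ) - s; omega,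
        (designWord_apply_mid X Y hX hY hsm mid r hr c (by omega) h).symm⟩
    · left
      rw [designWord_apply_ge X Y hX hY hsm mid r hr c (by omega)]
      exact Subtype.prop _
  · rintro (hx | ⟨i, hi, rfl⟩)
    · obtain ⟨c, hc, hcx⟩ := designWord_mem_Y X Y hX hY hsm mid r hr hx
      exact ⟨c, by omega, hcx⟩
    · refine ⟨⟨s + i, by have := i.isLt; omega⟩, by show s + j < s + (i : ℕ); omega, ?_⟩
      rw [designWord_apply_mid X Y hX hY hsm mid r hr _ (Nat.le_add_right _ _) (Nat.add_lt_add_left i.isLt s)]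
      congr 1
      exact Fin.ext (by simp)


/-- In a design word, `r ⟨s + i⟩ = mid i`. [folklore] -/
theorem designWord_apply_add (i : Fin m) :
    r ⟨s + (i : ℕ), by have := i.isLt; omega⟩ = mid i := by
  rw [designWord_apply_mid X Y hX hY hsm mid r hr _ (Nat.le_add_right _ _) (Nat.add_lt_add_left i.isLt s)]
  congr 1
  exact Fin.ext (by simp)

/-- **The valid splits of a design word are the middle positions**, provided the middle letters other
than the last avoid `X`, those other than the first avoid `Y`, distinct middle positions carry
distinct letters except possibly first = last, the first middle letter recurs after position `s`, and
the last middle letter occurs before position `s + m - 1`. [folklore] -/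
theorem designWord_valid_iff (hm : 0 < m)
    (hV1 : ∀ i : Fin m, (i : ℕ) + 1 < m → mid i ∉ X)
    (hV2 : ∀ i : Fin m, 0 < (i : ℕ) → mid i ∉ Y)
    (hV3 : ∀ i i' : Fin m, (i : ℕ) < i' → mid i = mid i' → (i : ℕ) = 0 ∧ (i' : ℕ) + 1 = m)
    (hI1 : ∃ p : Fin n, s < (p : ℕ) ∧ r p = r ⟨s, by omega⟩)
    (hI2 : ∃ p : Fin n, (p : ℕ) + 1 < s + m ∧ r p = r ⟨s + m - 1, by omega⟩)
    (c : Fin n) :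
    (((univ.filter fun c' : Fin n => (c' : ℕ) < c).image r).card = c ∧
      ((univ.filter fun c' : Fin n => (c : ℕ) < c').image r).card = n - 1 - c)
      ↔ (s ≤ (c : ℕ) ∧ (c : ℕ) < s + m) := by
  constructor
  · rintro ⟨hpre, hsuf⟩
    by_contra hc
    rcases Nat.lt_or_ge (c : ℕ) s with h | h
    · obtain ⟨p, hp, hpr⟩ := hI1
      exact suf_card_ne_of_repeat r c p ⟨s, by omega⟩ (fun h' => by rw [Fin.ext_iff] at h'; simp only at h'; omega)
        (by omega) (by simp only; omega) hpr hsuf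
    · have hc' : s + m ≤ (c : ℕ) := by omega
      obtain ⟨p, hp, hpr⟩ := hI2
      exact pre_card_ne_of_repeat r c p ⟨s + m - 1, by omega⟩
        (fun h' => by rw [Fin.ext_iff] at h'; simp only at h'; omega) (by omega) (by simp only; omega) hpr hpre
  · rintro ⟨h1, h2⟩
    obtain ⟨j, hj⟩ : ∃ j : ℕ, (c : ℕ) = s + j := ⟨(c : ℕ) - s, by omega⟩
    have hjm : j < m := by omega
    have hpre_eq : (univ.filter fun c' : Fin n => (c' : ℕ) < c).image r
        = X ∪ (univ.filter fun i : Fin m => (i : ℕ) < j).image mid := by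
      rw [← designWord_pre X Y hX hY hsm mid r hr j hjm.le, hj]
    have hsuf_eq : (univ.filter fun c' : Fin n => (c : ℕ) < c').image r
        = Y ∪ (univ.filter fun i : Fin m => j < (i : ℕ)).image mid := by
      rw [← designWord_suf X Y hX hY hsm mid r hr j hjm, hj]
    constructor
    · rw [hpre_eq, Finset.card_union_of_disjoint, hX, Finset.card_image_of_injOn, Fin.card_filter_val_lt,
        min_eq_right hjm.le, hj]
      · intro i hi i' hi' h
        by_contra hne
        simp only [Finset.coe_filter, Finset.mem_univ, true_and, Set.mem_setOf_eq] at hi hi'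
        rcases lt_or_gt_of_ne (fun h' : (i : ℕ) = i' => hne (Fin.ext h')) with hlt | hlt
        · have := (hV3 i i' hlt h).2; omega
        · have := (hV3 i' i hlt h.symm).2; omega
      · exact Finset.disjoint_left.mpr fun x hxX hx => by
          obtain ⟨i, hi, rfl⟩ := Finset.mem_image.mp hx
          simp only [Finset.mem_filter, Finset.mem_univ, true_and] at hi
          exact hV1 i (by omega) hxX
    · rw [hsuf_eq, Finset.card_union_of_disjoint, hY, Finset.card_image_of_injOn, hj]
      · have hfc : (univ.filter fun i : Fin m => j < (i : ℕ)).card = m - 1 - j := by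
          have : (univ.filter fun i : Fin m => j < (i : ℕ)) = (univ.filter fun i : Fin m => (i : ℕ) < j + 1)ᶜ := by
            ext i; simp only [Finset.mem_filter, Finset.mem_univ, true_and, Finset.mem_compl]; omega
          rw [this, Finset.card_compl, Fin.card_filter_val_lt, Fintype.card_fin]; omega
        rw [hfc]; omega
      · intro i hi i' hi' h
        by_contra hne
        simp only [Finset.coe_filter, Finset.mem_univ, true_and, Set.mem_setOf_eq] at hi hi'
        rcases lt_or_gt_of_ne (fun h' : (i : ℕ) = i' => hne (Fin.ext h')) with hlt | hlt
        · have := (hV3 i i' hlt h).1; omega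
        · have := (hV3 i' i hlt h.symm).1; omega
      · exact Finset.disjoint_left.mpr fun x hxY hx => by
          obtain ⟨i, hi, rfl⟩ := Finset.mem_image.mp hx
          simp only [Finset.mem_filter, Finset.mem_univ, true_and] at hi
          exact hV2 i (by omega) hxY

end DesignWord

/-! ### The window identity with indices only at valid splits -/

section Window

variable {k : Type*} [CommRing k] [IsDomain k] {n N : ℕ} (e : Finset (Fin n) ≃ Fin (N + 1))

/-- `grenet_window_identity` with the row / column indices required only at VALID splits. [folklore] -/
theorem grenet_window_identity' (hn : n ≠ 0) (hN : 2 ^ n = N + 1)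
    (A' : Fin n × Fin n → Matrix (Fin N) (Fin N) k)
    (htr : ((Grenet.repr k n e).adjugate * ∑ v, (X v : MvPolynomial (Fin n × Fin n) k) • (A' v).map C).trace = 0)
    (r : Fin n → Fin n) (ι κ : Fin n → Fin N)
    (hι : ∀ s : Fin n, ((univ.filter fun c : Fin n => (c : ℕ) < s).image r).card = s →
      ((univ.filter fun c : Fin n => (s : ℕ) < c).image r).card = n - 1 - s →
      e.symm ((e univ).succAbove (ι s)) = (univ.filter fun c : Fin n => (c : ℕ) < s).image r)
    (hκ : ∀ s : Fin n, ((univ.filter fun c : Fin n => (c : ℕ) < s).image r).card = s →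
      ((univ.filter fun c : Fin n => (s : ℕ) < c).image r).card = n - 1 - s →
      e.symm ((e ∅).succAbove (κ s)) = ((univ.filter fun c : Fin n => (s : ℕ) < c).image r)ᶜ) :
    ∑ s ∈ univ.filter (fun s : Fin n => ((univ.filter fun c : Fin n => (c : ℕ) < s).image r).card = s ∧
        ((univ.filter fun c : Fin n => (s : ℕ) < c).image r).card = n - 1 - s),
      A' (r s, s) (ι s) (κ s) = 0 := by
  classical
  -- extend `ι`, `κ` to all prefix-valid / suffix-valid splits by choice
  have hrow : ∀ s : Fin n, ((univ.filter fun c : Fin n => (c : ℕ) < s).image r).card = s →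
      ∃ i : Fin N, e.symm ((e univ).succAbove i) = (univ.filter fun c : Fin n => (c : ℕ) < s).image r :=
    fun s hs => exists_grenet_row_eq e fun h => by
      rw [h, Finset.card_univ, Fintype.card_fin] at hs; have := s.isLt; omega
  have hcol : ∀ s : Fin n, ((univ.filter fun c : Fin n => (s : ℕ) < c).image r).card = n - 1 - s →
      ∃ j : Fin N, e.symm ((e ∅).succAbove j) = ((univ.filter fun c : Fin n => (s : ℕ) < c).image r)ᶜ :=
    fun s hs => exists_grenet_col_eq e fun h => by
      have h' := congrArg Finset.card h
      rw [Finset.card_compl, hs, Fintype.card_fin, Finset.card_empty] at h'; have := s.isLt; omega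
  haveI : Nonempty (Fin N) := ⟨⟨0, by have := Nat.le_self_pow hn 2; omega⟩⟩
  choose! ι₀ hι₀ using hrow
  choose! κ₀ hκ₀ using hcol
  have h := grenet_window_identity e hn hN A' htr r
    (fun s => if ((univ.filter fun c : Fin n => (c : ℕ) < s).image r).card = s ∧
        ((univ.filter fun c : Fin n => (s : ℕ) < c).image r).card = n - 1 - s then ι s else ι₀ s)
    (fun s => if ((univ.filter fun c : Fin n => (c : ℕ) < s).image r).card = s ∧
        ((univ.filter fun c : Fin n => (s : ℕ) < c).image r).card = n - 1 - s then κ s else κ₀ s)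
    (fun s hs => by
      by_cases hv : ((univ.filter fun c : Fin n => (c : ℕ) < s).image r).card = s ∧
          ((univ.filter fun c : Fin n => (s : ℕ) < c).image r).card = n - 1 - s
      · rw [if_pos hv]; exact hι s hv.1 hv.2
      · rw [if_neg hv]; exact hι₀ s hs)
    (fun s hs => by
      by_cases hv : ((univ.filter fun c : Fin n => (c : ℕ) < s).image r).card = s ∧
          ((univ.filter fun c : Fin n => (s : ℕ) < c).image r).card = n - 1 - s
      · rw [if_pos hv]; exact hκ s hv.1 hv.2
      · rw [if_neg hv]; exact hκ₀ s hs)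
  rw [← h]
  refine Finset.sum_congr rfl fun s hs => ?_
  have hv := (Finset.mem_filter.mp hs).2
  simp only [if_pos hv]

end Window

end Summit.ValiantsHypothesis.Theorems.RigidityForcesSymmetry.GrenetGauge
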